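import Summits.CriticalPhenomena.PercolationContinuityZ3.Theorems.PercNearOneGluingNoHeavyLowerTailCSHDefs
import Summits.CriticalPhenomena.PercolationContinuityZ3.Theorems.PercNearOneGluingNoHeavyLowerTailCSHUnfoldOneTools
import HarnessLib

/-!
# Crux `PercNearOneGluing.AdditiveGluing` (stmt-CriticalPhenomena-4576): the conditioned slack hierarchy — the ONE-STEP ALGEBRAIC
# UNFOLDING of the level form on connection indicators (the CLAIM of Lemma U, general step)

Support file (`--supports stmt-CriticalPhenomena-4576`, lead-of-record prim-png-lead-4576 gen 12; piece P5 (general number of decoys), part (a),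
of the cell's Lean socket `prim-hp-8/SOCKET-CSH-LEAN.md` for `prim-hp-8/PROOF-S5-ALL-R.md` §3.3).  No definitions, no named facts, no sorries.

THE CLAIM OF LEMMA U, ONE STEP, GENERAL SET (memo §3.3, `J^{i-1}_u − c_i(u) J^{i-1}_{d_i} = J^i_u − c_i(u) − 1{E_i} M^{(i,i)}_u`).  In a FIXED
configuration `ζ`, write `J_S(u) = 1{u ↔ S}` (`u` is joined to some vertex of the set `S`).  For a decoy `d` with an ARBITRARY constant function `c`:

  `slStep (d,c) J_S = J_{S ∪ {d}} − c − 1{d ↮ S}·(1{d ↔ ·} − c)`           (`slStep_connSet`),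

(`1{u ↔ S} = 1{u ↔ S∪d} − 1{u ↔ d}·1{d ↮ S}`, `1{d ↔ S} = 1 − 1{d ↮ S}`), hence for every tail `L` of decoys, by the definitional peeling
`slForm ((d,c)::L) f = slForm L (slStep (d,c) f)` and linearity,

  `slForm ((d,c)::L) J_S u = slForm L J_{S∪{d}} u − slForm L c u − 1{d ↮ S}·slForm L (1{d ↔ ·} − c) u`     (`slForm_cons_connSet`).

This is prim-hp-8's `CSH.level_one_split` (the case `S = {x}`, `L = []`) for a general set `S` and a general tail: iterating it along the decoy list
unfolds `slForm L [1{x ↔ ·}]` into the set indicator `1{· ↔ {x} ∪ D}` (the H-part of the memo), deterministic constants, and one term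
`1{d_j ↮ {x} ∪ D_{<j}}·slForm L_{>j} (1{d_j ↔ ·} − c_j)` per decoy (the R̃-parts, level forms of the TAILS — the "natural conditioning" of §3.5).
The constants `c` are arbitrary reals here (no percolation input), so the identities hold pointwise in every world.
[cite: KozmaNitzan2024, Conj. 4 (p. 32)] [cite: VandenbergHaggstromKahn2005, §1 display (10) (pp. 7–8)]
-/

noncomputable section

namespace Summit.CriticalPhenomena.PercolationContinuityZ3.Theorems.CSH

open MeasureTheory Set Literature.Probability.Percolation
open scoped Classical
open DecisionTree HullPort

variable {V : Type*}

/-- `1{u ↔ S ∪ {d}} = 1{u ↔ S}` when `d ↔ S` (a path to `d` continues to `S`). [folklore] -/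
theorem ind_connSet_insert_of_not_avoid (S : Set V) (d u : V) (ζ : Set (Sym2 V)) (h : ζ ∉ avoidEv d S) :
    ind {ζ' : Set (Sym2 V) | ∃ s ∈ insert d S, (openGraph ζ').Reachable s u} ζ =
      ind {ζ' : Set (Sym2 V) | ∃ s ∈ S, (openGraph ζ').Reachable s u} ζ := by
  -- `d ↔ s₀` for some `s₀ ∈ S`
  have hds : ∃ s ∈ S, (openGraph ζ).Reachable d s := by
    by_contra hcon
    exact h fun s hs hds => hcon ⟨s, hs, hds⟩
  obtain ⟨s₀, hs₀, hds₀⟩ := hds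
  by_cases hu : ∃ s ∈ S, (openGraph ζ).Reachable s u
  · rw [ind_of_mem (show ζ ∈ {ζ' : Set (Sym2 V) | ∃ s ∈ S, (openGraph ζ').Reachable s u} from hu), ind_of_mem]
    obtain ⟨s, hs, hsu⟩ := hu
    exact ⟨s, mem_insert_of_mem d hs, hsu⟩
  · rw [ind_of_not_mem (show ζ ∉ {ζ' : Set (Sym2 V) | ∃ s ∈ S, (openGraph ζ').Reachable s u} from hu), ind_of_not_mem]
    rintro ⟨s, hs, hsu⟩
    rcases mem_insert_iff.1 hs with rfl | hs'
    · exact hu ⟨s₀, hs₀, hds₀.symm.trans hsu⟩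
    · exact hu ⟨s, hs', hsu⟩

/-- `1{u ↔ S ∪ {d}} = 1{u ↔ S} + 1{d ↔ u}` when `d ↮ S` (the two events are then disjoint). [folklore] -/
theorem ind_connSet_insert_of_avoid (S : Set V) (d u : V) (ζ : Set (Sym2 V)) (h : ζ ∈ avoidEv d S) :
    ind {ζ' : Set (Sym2 V) | ∃ s ∈ insert d S, (openGraph ζ').Reachable s u} ζ =
      ind {ζ' : Set (Sym2 V) | ∃ s ∈ S, (openGraph ζ').Reachable s u} ζ + ind (openConn d u : Set (BondConfig V)) ζ := by
  by_cases hu : ∃ s ∈ S, (openGraph ζ).Reachable s u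
  · have hdu : ¬ (openGraph ζ).Reachable d u := by
      obtain ⟨s, hs, hsu⟩ := hu
      exact fun hdu => h s hs (hdu.trans hsu.symm)
    rw [ind_of_mem (show ζ ∈ {ζ' : Set (Sym2 V) | ∃ s ∈ S, (openGraph ζ').Reachable s u} from hu),
      ind_of_not_mem (show ζ ∉ (openConn d u : Set (BondConfig V)) from hdu), add_zero, ind_of_mem]
    obtain ⟨s, hs, hsu⟩ := hu
    exact ⟨s, mem_insert_of_mem d hs, hsu⟩
  · rw [ind_of_not_mem (show ζ ∉ {ζ' : Set (Sym2 V) | ∃ s ∈ S, (openGraph ζ').Reachable s u} from hu), zero_add]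
    by_cases hdu : (openGraph ζ).Reachable d u
    · rw [ind_of_mem (show ζ ∈ (openConn d u : Set (BondConfig V)) from hdu), ind_of_mem]
      exact ⟨d, mem_insert d S, hdu⟩
    · rw [ind_of_not_mem (show ζ ∉ (openConn d u : Set (BondConfig V)) from hdu), ind_of_not_mem]
      rintro ⟨s, hs, hsu⟩
      rcases mem_insert_iff.1 hs with rfl | hs'
      · exact hdu hsu
      · exact hu ⟨s, hs', hsu⟩

/-- **One level step on a set-connection indicator** (the CLAIM of Lemma U, memo §3.3, one step, general set `S`, arbitrary constants `c`):
`slStep (d,c) J_S = J_{S∪{d}} − c − 1{d ↮ S}·(1{d ↔ ·} − c)` pointwise in the configuration `ζ`.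
(transcription of the cell memo prim-hp-8 PROOF-S5-ALL-R.md §3.3) [folklore] -/
theorem slStep_connSet (S : Set V) (d : V) (c : V → ℝ) (ζ : Set (Sym2 V)) :
    slStep (d, c) (fun u => ind {ζ' : Set (Sym2 V) | ∃ s ∈ S, (openGraph ζ').Reachable s u} ζ) =
      fun u => ind {ζ' : Set (Sym2 V) | ∃ s ∈ insert d S, (openGraph ζ').Reachable s u} ζ - c u -
        ind (avoidEv d S) ζ * (ind (openConn d u : Set (BondConfig V)) ζ - c u) := by
  funext u
  simp only [slStep]
  by_cases h : ζ ∈ avoidEv d S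
  · -- `d ↮ S`: `J_S(d) = 0`, `J_{S∪d}(u) = J_S(u) + 1{d↔u}`
    have hJd : ind {ζ' : Set (Sym2 V) | ∃ s ∈ S, (openGraph ζ').Reachable s d} ζ = 0 :=
      ind_of_not_mem fun ⟨s, hs, hsd⟩ => h s hs hsd.symm
    rw [hJd, ind_of_mem h, ind_connSet_insert_of_avoid S d u ζ h]
    ring
  · -- `d ↔ S`: `J_S(d) = 1`, `J_{S∪d} = J_S`
    have hJd : ind {ζ' : Set (Sym2 V) | ∃ s ∈ S, (openGraph ζ').Reachable s d} ζ = 1 := by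
      refine ind_of_mem ?_
      by_contra hcon
      exact h fun s hs hds => hcon ⟨s, hs, hds.symm⟩
    rw [hJd, ind_of_not_mem h, ind_connSet_insert_of_not_avoid S d u ζ h]
    ring

/-- **One decoy peeled off the level form of a set-connection indicator** (memo §3.3 CLAIM, inductive step, for an arbitrary tail `L`):
`slForm ((d,c)::L) J_S u = slForm L J_{S∪{d}} u − slForm L c u − 1{d ↮ S}·slForm L (1{d ↔ ·} − c) u`.
(transcription of the cell memo prim-hp-8 PROOF-S5-ALL-R.md §3.3) [folklore] -/
theorem slForm_cons_connSet (S : Set V) (d : V) (c : V → ℝ) (L : List (V × (V → ℝ))) (ζ : Set (Sym2 V)) (u : V) :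
    slForm ((d, c) :: L) (fun u' => ind {ζ' : Set (Sym2 V) | ∃ s ∈ S, (openGraph ζ').Reachable s u'} ζ) u =
      slForm L (fun u' => ind {ζ' : Set (Sym2 V) | ∃ s ∈ insert d S, (openGraph ζ').Reachable s u'} ζ) u -
        slForm L c u -
        ind (avoidEv d S) ζ * slForm L (fun u' => ind (openConn d u' : Set (BondConfig V)) ζ - c u') u := by
  rw [slForm_cons_eq, slStep_connSet]
  have e : (fun u' => ind {ζ' : Set (Sym2 V) | ∃ s ∈ insert d S, (openGraph ζ').Reachable s u'} ζ - c u' -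
        ind (avoidEv d S) ζ * (ind (openConn d u' : Set (BondConfig V)) ζ - c u')) =
      (fun u' => ind {ζ' : Set (Sym2 V) | ∃ s ∈ insert d S, (openGraph ζ').Reachable s u'} ζ) - c -
        ind (avoidEv d S) ζ • (fun u' => ind (openConn d u' : Set (BondConfig V)) ζ - c u') := by
    funext u'; simp only [Pi.sub_apply, Pi.smul_apply, smul_eq_mul]
  rw [e, slForm_sub, slForm_sub, slForm_smul]
  simp only [Pi.sub_apply, Pi.smul_apply, smul_eq_mul]

/-- The single-owner connection indicator is the set indicator of the singleton: `1{x ↔ u} = J_{{x}}(u)`. [folklore] -/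
theorem ind_openConn_eq_connSet_singleton (x u : V) (ζ : Set (Sym2 V)) :
    ind (openConn x u : Set (BondConfig V)) ζ = ind {ζ' : Set (Sym2 V) | ∃ s ∈ ({x} : Set V), (openGraph ζ').Reachable s u} ζ := by
  by_cases h : (openGraph ζ).Reachable x u
  · rw [ind_of_mem (show ζ ∈ (openConn x u : Set (BondConfig V)) from h), ind_of_mem]
    exact ⟨x, mem_singleton x, h⟩
  · rw [ind_of_not_mem (show ζ ∉ (openConn x u : Set (BondConfig V)) from h), ind_of_not_mem]
    rintro ⟨s, hs, hsu⟩
    rw [mem_singleton_iff] at hs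
    exact h (hs ▸ hsu)

end Summit.CriticalPhenomena.PercolationContinuityZ3.Theorems.CSH

end
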